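import Mathlib

/-!
Sketch — first lemmas for the crux ideas on `ConvexGribovBody.BrascampLiebVacuum`
(crux item stmt-QuantumFields-8779). Signatures only (as `Prop`s); nothing here is filed.
-/

namespace Summit.QuantumFields.YangMills.Cruxes.BrascampLiebVacuum.Sketch

open scoped BigOperators Matrix Real
open MeasureTheory intervalIntegral

/-! ### Card `dynamical-cramer-rao` -/

/-- First lemma (algebraic core of "Cramér–Rao fixes the Brascamp–Lieb modulus"):
if the observed information `H x` dominates a fixed fraction `c` of the expected information
`Hbar`, and `Hbar` dominates the inverse covariance `S⁻¹` (matrix Cramér–Rao), then the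
Brascamp–Lieb kernel `(H x)⁻¹` is dominated by `c⁻¹ • S`, i.e. by a multiple of the covariance. -/
def CRFixesModulus : Prop :=
  ∀ (n : ℕ) (c : ℝ) (H Hbar S : Matrix (Fin n) (Fin n) ℝ), 0 < c →
    H.PosDef → Hbar.PosDef → S.PosDef →
    (H - c • Hbar).PosSemidef → (Hbar - S⁻¹).PosSemidef →
    (c⁻¹ • S - H⁻¹).PosSemidef

/-- First lemma (the Cramér–Rao inequality on one compact `U(1)` link, the toy of the
left-invariant version on `G^E`): for a positive `C¹` probability density `ρ` on the circle
(written as a `2π`-periodic function) and a `C¹` periodic test function `f`,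
`(∫ f' ρ)² ≤ Var_ρ(f) · I(ρ)` with `I(ρ) = ∫ (ρ')²/ρ = ∫ (−log ρ)'' ρ` the Fisher information.
No boundary terms: the link is compact without boundary. -/
def CircleCramerRao : Prop :=
  ∀ (ρ f : ℝ → ℝ), ContDiff ℝ 1 ρ → ContDiff ℝ 1 f →
    Function.Periodic ρ (2 * π) → Function.Periodic f (2 * π) → (∀ x, 0 < ρ x) →
    (∫ x in (0 : ℝ)..(2 * π), ρ x) = 1 →
    (∫ x in (0 : ℝ)..(2 * π), deriv f x * ρ x) ^ 2 ≤
      ((∫ x in (0 : ℝ)..(2 * π), (f x) ^ 2 * ρ x) - (∫ x in (0 : ℝ)..(2 * π), f x * ρ x) ^ 2) *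
        ∫ x in (0 : ℝ)..(2 * π), (deriv ρ x) ^ 2 / ρ x

/-- First lemma (finite-dimensional "dynamical Cramér–Rao ⇒ covariance-shaped Poincaré",
the exact shape of the crux's conclusion): on `ℝⁿ` with a smooth positive probability density
`ρ = exp(-Φ)`, IF the 1-form Witten operator dominates the constant potential `c • S⁻¹`
in the quadratic-form sense on gradient fields — `∫ (‖∇ω‖² + ⟪ω, Hess Φ ω⟫) ρ ≥ c ∫ ⟪ω, S⁻¹ ω⟫ ρ`
for `ω = ∇u` — THEN `Var_ρ(f) ≤ c⁻¹ ∫ ⟪∇f, S ∇f⟫ ρ` for smooth compactly supported `f`.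
(Helffer–Sjöstrand representation `Var f = ⟪∇f, 𝔚⁻¹ ∇f⟫`; stated here with Fréchet derivatives.) -/
def DynamicalCramerRaoPoincare : Prop :=
  ∀ (n : ℕ) (c : ℝ) (Φ : EuclideanSpace ℝ (Fin n) → ℝ) (S : Matrix (Fin n) (Fin n) ℝ),
    0 < c → S.PosDef → ContDiff ℝ 2 Φ →
    Integrable (fun x => Real.exp (-Φ x)) → (∫ x, Real.exp (-Φ x)) = 1 →
    (∀ u : EuclideanSpace ℝ (Fin n) → ℝ, ContDiff ℝ 3 u → HasCompactSupport u →
      c * ∫ x, (∑ i, ∑ j, (fderiv ℝ u x (EuclideanSpace.single i 1)) * (S⁻¹) i j *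
            (fderiv ℝ u x (EuclideanSpace.single j 1))) * Real.exp (-Φ x)
        ≤ ∫ x, ((∑ i, ∑ j, (iteratedFDeriv ℝ 2 u x ![EuclideanSpace.single i 1, EuclideanSpace.single j 1]) ^ 2)
            + ∑ i, ∑ j, (fderiv ℝ u x (EuclideanSpace.single i 1)) *
                (iteratedFDeriv ℝ 2 Φ x ![EuclideanSpace.single i 1, EuclideanSpace.single j 1]) *
                (fderiv ℝ u x (EuclideanSpace.single j 1))) * Real.exp (-Φ x)) →
    ∀ f : EuclideanSpace ℝ (Fin n) → ℝ, ContDiff ℝ 1 f → HasCompactSupport f →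
      (∫ x, (f x - ∫ y, f y * Real.exp (-Φ y)) ^ 2 * Real.exp (-Φ x))
        ≤ c⁻¹ * ∫ x, (∑ i, ∑ j, (fderiv ℝ f x (EuclideanSpace.single i 1)) * S i j *
            (fderiv ℝ f x (EuclideanSpace.single j 1))) * Real.exp (-Φ x)


/-- First lemma (the "equal-time block" step): for a positive definite block matrix `M = [[A, B], [Bᵀ, D]]`
(think `M = E[Hess Φ]` or `M = Cov₄⁻¹`, first block = the `t = 0` spatial directions), the first diagonal
block of `M⁻¹` dominates the inverse of the first diagonal block of `M` (Schur complement); read with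
`M = Cov₄` it says `(Cov₄⁻¹)₀₀ ≥ (Cov₀₀)⁻¹`, so `λ_min(E[Hess]₀₀) ≥ 1/λ_max(Cov₀₀) ≥ 1/Dmax`. -/
def SchurBlockCR : Prop :=
  ∀ (m k : ℕ) (A : Matrix (Fin m) (Fin m) ℝ) (B : Matrix (Fin m) (Fin k) ℝ) (D : Matrix (Fin k) (Fin k) ℝ),
    (Matrix.fromBlocks A B Bᵀ D).PosDef →
    (((Matrix.fromBlocks A B Bᵀ D)⁻¹).toBlocks₁₁ - A⁻¹).PosSemidef

/-- First lemma (weak form, the one a skeleton should target): if the one-form Witten operator `W`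
dominates `c · λ_min(Hbar)` (`Hbar` = EXPECTED Hessian, `m` its least eigenvalue), and Cramér–Rao
`Hbar ≥ S⁻¹` holds with `S ≤ s • 1` (`s = λ_max(Cov) ≤ Dmax`), then `W⁻¹ ≤ c⁻¹ s • 1` — the crux's
shape `Var ≤ C · Dmax · Dirichlet` with `C = 1/c`. Finite-dimensional matrix model of the chain. -/
def WeakFormChain : Prop :=
  ∀ (n : ℕ) (c m s : ℝ) (W Hbar S : Matrix (Fin n) (Fin n) ℝ), 0 < c → 0 < s →
    W.PosDef → Hbar.PosDef → S.PosDef →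
    (Hbar - m • (1 : Matrix (Fin n) (Fin n) ℝ)).PosSemidef →
    (∀ m' : ℝ, (Hbar - m' • (1 : Matrix (Fin n) (Fin n) ℝ)).PosSemidef → m' ≤ m) →
    (Hbar - S⁻¹).PosSemidef → (s • (1 : Matrix (Fin n) (Fin n) ℝ) - S).PosSemidef →
    (W - (c * m) • (1 : Matrix (Fin n) (Fin n) ℝ)).PosSemidef →
    ((c⁻¹ * s) • (1 : Matrix (Fin n) (Fin n) ℝ) - W⁻¹).PosSemidef

/-! ### Recorded dead line (NOT a card): Lipschitz transport from a covariance-matched Gaussian.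
A `K`-Lipschitz push-forward only transports the SCALAR Poincaré constant `K² · λ_max(Cov₄)` of the 4d
reference Gaussian (≍ ξ²/β), not the equal-time block (≍ ξ/β) the crux needs; kept here as the
statement that was checked and found too weak (see NOTES.md, dead line (h)). -/
def LipschitzPushforwardPoincare : Prop :=
  ∀ (n : ℕ) (γ : Measure (EuclideanSpace ℝ (Fin n))) [IsProbabilityMeasure γ] (CP : ℝ) (K : NNReal)
    (T : EuclideanSpace ℝ (Fin n) → EuclideanSpace ℝ (Fin n)), LipschitzWith K T → ContDiff ℝ 1 T →
    (∀ g : EuclideanSpace ℝ (Fin n) → ℝ, ContDiff ℝ 1 g → HasCompactSupport g →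
      (∫ x, (g x - ∫ y, g y ∂γ) ^ 2 ∂γ) ≤ CP * ∫ x, ‖fderiv ℝ g x‖ ^ 2 ∂γ) →
    ∀ f : EuclideanSpace ℝ (Fin n) → ℝ, ContDiff ℝ 1 f → HasCompactSupport f →
      (∫ x, (f x - ∫ y, f y ∂(γ.map T)) ^ 2 ∂(γ.map T)) ≤
        (K : ℝ) ^ 2 * CP * ∫ x, ‖fderiv ℝ f x‖ ^ 2 ∂(γ.map T)

end Summit.QuantumFields.YangMills.Cruxes.BrascampLiebVacuum.Sketch
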